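import Mathlib
import HarnessLib
import Summits.Ventures.LatticeQCDFlow.Scoring.ChainTimeAverage
import Summits.Ventures.LatticeQCDFlow.Scoring.FlowSamplerAutocorrelation

/-!
# Warm-start transfer: an initial law `μ₀ ≤ M·π` makes every non-negative path functional of the
# simulated chain at most `M ×` its stationary value — the exact flow sampler started from a draw
# of its own model has `E[(A_N − πf)²] ≤ e^{2δ}(2e^{2δ} − 1) Var_π f / N`, UNCONDITIONALLY on `SU(n)^E`

HONEST FRAMING: exact (Metropolis-corrected) sampling algorithms for lattice gauge theory;
figures of merit are autocorrelation/cost numbers at stated couplings and volumes; no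
continuum-physics claim.

Venture `LatticeQCDFlow` (cell pub-lqcd), topic `Scoring`; FANOUT row 8 (`s0-cpn-nemc`, GEN-13).
NEW WORK of the cell, not a published result; no definition is introduced.  The bridge
`Scoring/ChainTimeAverage.lean` prices the time average of the chain STARTED IN `π`
(`Var = 2τ_N Var_π f/N ≤ (2/ε − 1) Var_π f/N`); practice starts elsewhere.  This file records the
elementary transfer principle for Mathlib's Ionescu-Tulcea trajectory measure — it is monotone and
homogeneous in the initial law, so `μ₀ ≤ M • π` gives `P_{μ₀} ≤ M • P_π` on path space and every
non-negative functional (squared errors, exit indicators, hitting costs) transfers with the factor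
`M` — and instantiates it where `M` is CERTIFIED: the exact flow-MCMC sampler of
`Exactness.flowSampler_exact_doeblin` (row 30 / lean-2, UNCONDITIONAL on `SU(n)^E`: weight
`e^{−2δ} ≤ w ≤ e^{2δ}`, `w · q = π`) started, as practitioners do, from a draw of its own model `q`,
for which `q ≤ e^{2δ} • π`.  Printed counterpart NAMED ONLY: the "warm start" device of the MCMC
literature (e.g. Lovász–Simonovits 1993; named, not restated, not cited as a fact).

## Content

* `comp_mono_measure`, **`trajMeasure_le_smul`** — `μ ≤ ν ⇒ κ ∘ₘ μ ≤ κ ∘ₘ ν`, and for every family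
  of Markov kernels `μ₀ ≤ M • ν₀ ⇒ trajMeasure μ₀ κ ≤ M • trajMeasure ν₀ κ` (general
  Ionescu-Tulcea setting, history-dependent kernels allowed);
* `integral_le_of_le_smul` — `μ ≤ M • ν`, `Φ ≥ 0` `ν`-integrable ⇒ `∫ Φ dμ ≤ M ∫ Φ dν`;
  `le_smul_of_withDensity_eq` — `w ≥ w_lo > 0`, `w · q = π ⇒ q ≤ w_lo⁻¹ • π`;
* `chain_mean_timeAverage`, **`chain_sqError_eq_variance`** — started in `π`, `E[A_N] = πf` and
  `E[(A_N − πf)²] = Var[A_N]` (`A_N = (1/N) Σ_{i<N} f(X_i)`, `N ≥ 1`);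
* **`chain_mse_le_of_le_smul`** — `μ₀ ≤ M • π ⇒ E_{μ₀}[(A_N − πf)²] ≤ M · Var_{P_π}[A_N]`;
  **`chain_mse_le_of_le_smul_doeblin`** — with `κ(x, ·) ≥ ε π`: `≤ M (2/ε − 1) Var_π f / N`;
* **`flowSampler_mse_from_model_le`** — THE INSTANCE (hypotheses of
  `Scoring.flowSampler_autocorrelation`: smooth `S`, jointly smooth flow action with uniform defect
  `δ` of Lüscher's equation on `[0,1] × SU(n)^E`, `q = (𝓕_1)_* D[V]`): for the exact flow sampler
  `K = indepMH q w` started from `X_0 ∼ q`, every bounded measurable `f`, every `N ≥ 1`: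
  `E_q[((1/N) Σ_{i<N} f(U_i) − πf)²] ≤ e^{2δ} · (2e^{2δ} − 1) · Var_π f / N`.

Reading (value-free): for the exact flow sampler the usual start — propose once from the flow and go
— carries a certified mean-square error on every bounded observable with no burn-in and no
stationarity assumption, at the price of one more factor `e^{2δ}`; combined with
`Scoring/ChainMeanSquareError.lean` (any start, `O(1/N²)` correction) the two bounds can be taken as
a minimum.  NOT CLAIMED: any value of `δ`; unbounded observables; estimator statements; that
`e^{2δ}` is the best warm-start constant.
-/

noncomputable section

namespace Summit.Ventures.LatticeQCDFlow.Scoring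

open MeasureTheory ProbabilityTheory Filter Finset Preorder Summit.Ventures.LatticeQCDFlow.Exactness
open scoped ENNReal

/-! ### Monotonicity of composition and of the trajectory measure in the initial law -/

section Transfer

variable {α β : Type*} [MeasurableSpace α] [MeasurableSpace β]

/-- `μ ≤ ν ⇒ κ ∘ₘ μ ≤ κ ∘ₘ ν`. -/
theorem comp_mono_measure (κ : Kernel α β) {μ ν : Measure α} (h : μ ≤ ν) : κ ∘ₘ μ ≤ κ ∘ₘ ν :=
  Measure.le_iff.2 fun s hs => by
    rw [Measure.bind_apply hs κ.aemeasurable, Measure.bind_apply hs κ.aemeasurable]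
    exact lintegral_mono' h le_rfl

/-- **The trajectory measure is dominated like its initial law**: `μ₀ ≤ M • ν₀ ⇒
trajMeasure μ₀ κ ≤ M • trajMeasure ν₀ κ` (Ionescu-Tulcea; any family of Markov kernels). -/
theorem trajMeasure_le_smul {X : ℕ → Type*} [∀ n, MeasurableSpace (X n)]
    (κ : (n : ℕ) → Kernel ((i : ↥(Finset.Iic n)) → X i) (X (n + 1))) [∀ n, IsMarkovKernel (κ n)]
    {μ₀ ν₀ : Measure (X 0)} {M : ℝ≥0∞} (h : μ₀ ≤ M • ν₀) :
    Kernel.trajMeasure μ₀ κ ≤ M • Kernel.trajMeasure ν₀ κ := by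
  rw [Kernel.trajMeasure, Kernel.trajMeasure, ← Measure.comp_smul, ← Measure.map_smul]
  exact comp_mono_measure _ (Measure.map_mono h (MeasurableEquiv.measurable _))

/-- Non-negative functionals transfer with the factor `M`: `μ ≤ M • ν`, `0 ≤ Φ` `ν`-integrable ⇒
`∫ Φ dμ ≤ M · ∫ Φ dν`. -/
theorem integral_le_of_le_smul {μ ν : Measure α} {M : ℝ≥0∞} (hM : M ≠ ⊤) (h : μ ≤ M • ν)
    {Φ : α → ℝ} (hΦ0 : ∀ x, 0 ≤ Φ x) (hint : Integrable Φ ν) :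
    ∫ x, Φ x ∂μ ≤ M.toReal * ∫ x, Φ x ∂ν :=
  calc ∫ x, Φ x ∂μ ≤ ∫ x, Φ x ∂(M • ν) :=
        integral_mono_measure h (ae_of_all _ hΦ0) (hint.smul_measure hM)
    _ = M.toReal * ∫ x, Φ x ∂ν := by rw [integral_smul_measure, smul_eq_mul]

/-- A weight floor is a domination: `w ≥ w_lo > 0` and `w · q = π` give `q ≤ w_lo⁻¹ • π`. -/
theorem le_smul_of_withDensity_eq {q π : Measure α} {w : α → ℝ} {wlo : ℝ} (hwlo : 0 < wlo)
    (hle : ∀ x, wlo ≤ w x) (hπ : q.withDensity (fun x => ENNReal.ofReal (w x)) = π) :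
    q ≤ ENNReal.ofReal wlo⁻¹ • π := by
  refine Measure.le_iff.2 fun s hs => ?_
  rw [Measure.smul_apply, smul_eq_mul, ← hπ, withDensity_apply _ hs]
  calc q s = ENNReal.ofReal wlo⁻¹ * (ENNReal.ofReal wlo * q s) := by
        rw [← mul_assoc, ← ENNReal.ofReal_mul (inv_pos.2 hwlo).le, inv_mul_cancel₀ hwlo.ne',
          ENNReal.ofReal_one, one_mul]
    _ = ENNReal.ofReal wlo⁻¹ * ∫⁻ _ in s, ENNReal.ofReal wlo ∂q := by rw [setLIntegral_const]
    _ ≤ ENNReal.ofReal wlo⁻¹ * ∫⁻ x in s, ENNReal.ofReal (w x) ∂q :=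
        mul_le_mul' le_rfl (lintegral_mono fun x => ENNReal.ofReal_le_ofReal (hle x))

end Transfer

/-! ### The squared error of the time average under a dominated start -/

section Chain

variable {Ω : Type*} [MeasurableSpace Ω]
variable {κ : Kernel Ω Ω} [IsMarkovKernel κ] {μ₀ : Measure Ω} [IsProbabilityMeasure μ₀]
  {π : Measure Ω} [IsProbabilityMeasure π]

omit [MeasurableSpace Ω] in
/-- The time average of a bounded observable is bounded: `|(1/N) Σ_{i<N} f(x_i)| ≤ C` (`N ≥ 1`). -/
theorem abs_timeAverage_le {f : Ω → ℝ} {C : ℝ} (hC : ∀ x, |f x| ≤ C) {N : ℕ} (hN : N ≠ 0)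
    (x : ℕ → Ω) : |(∑ i ∈ Finset.range N, f (x i)) / N| ≤ C := by
  have hNpos : (0 : ℝ) < N := by exact_mod_cast Nat.pos_of_ne_zero hN
  rw [abs_div, abs_of_pos hNpos, div_le_iff₀ hNpos]
  calc |∑ i ∈ Finset.range N, f (x i)| ≤ ∑ i ∈ Finset.range N, |f (x i)| := Finset.abs_sum_le_sum_abs _ _
    _ ≤ ∑ i ∈ Finset.range N, C := Finset.sum_le_sum fun i _ => hC (x i)
    _ = C * N := by rw [Finset.sum_const, Finset.card_range, nsmul_eq_mul, mul_comm]

/-- … and measurable as a path functional. -/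
theorem measurable_timeAverage {f : Ω → ℝ} (hf : Measurable f) (N : ℕ) :
    Measurable fun x : ℕ → Ω => (∑ i ∈ Finset.range N, f (x i)) / N :=
  (Finset.measurable_sum _ fun i _ => hf.comp (measurable_pi_apply i)).div_const _

/-- **Started in `π`, the mean of the time average is `πf`.** -/
theorem chain_mean_timeAverage (hπ : Kernel.Invariant κ π) {f : Ω → ℝ} (hf : Measurable f) {C : ℝ}
    (hC : ∀ x, |f x| ≤ C) {N : ℕ} (hN : N ≠ 0) :
    ∫ x, (∑ i ∈ Finset.range N, f (x i)) / N ∂(Kernel.trajMeasure (X := fun _ : ℕ => Ω) π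
        (fun n : ℕ => κ.comap (fun h : (i : ↥(Finset.Iic n)) → Ω => h ⟨n, Finset.mem_Iic.2 le_rfl⟩)
          (measurable_pi_apply _)))
      = ∫ z, f z ∂π := by
  set P := Kernel.trajMeasure (X := fun _ : ℕ => Ω) π
      (fun n : ℕ => κ.comap (fun h : (i : ↥(Finset.Iic n)) → Ω => h ⟨n, Finset.mem_Iic.2 le_rfl⟩)
        (measurable_pi_apply _)) with hP
  have hN' : (N : ℝ) ≠ 0 := by exact_mod_cast hN
  have hint : ∀ i, Integrable (fun x : ℕ → Ω => f (x i)) P := fun i =>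
    integrable_of_bounded P (hf.comp (measurable_pi_apply i)) fun x => hC (x i)
  have hmarg : ∀ i, ∫ x, f (x i) ∂P = ∫ z, f z ∂π := fun i => by
    rw [hP]; exact chain_marginal hπ i hf hC
  rw [integral_div, integral_finsetSum _ (fun i _ => hint i), Finset.sum_congr rfl fun i _ => hmarg i,
    Finset.sum_const, Finset.card_range, nsmul_eq_mul]
  field_simp

/-- **Started in `π`, the squared error about `πf` is the variance of the time average.** -/
theorem chain_sqError_eq_variance (hπ : Kernel.Invariant κ π) {f : Ω → ℝ} (hf : Measurable f)
    {C : ℝ} (hC : ∀ x, |f x| ≤ C) {N : ℕ} (hN : N ≠ 0) :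
    ∫ x, ((∑ i ∈ Finset.range N, f (x i)) / N - ∫ z, f z ∂π) ^ 2
        ∂(Kernel.trajMeasure (X := fun _ : ℕ => Ω) π
          (fun n : ℕ => κ.comap (fun h : (i : ↥(Finset.Iic n)) → Ω => h ⟨n, Finset.mem_Iic.2 le_rfl⟩)
            (measurable_pi_apply _)))
      = Var[fun x : ℕ → Ω => (∑ i ∈ Finset.range N, f (x i)) / N;
          Kernel.trajMeasure (X := fun _ : ℕ => Ω) π
            (fun n : ℕ => κ.comap (fun h : (i : ↥(Finset.Iic n)) → Ω => h ⟨n, Finset.mem_Iic.2 le_rfl⟩)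
              (measurable_pi_apply _))] := by
  rw [variance_eq_integral (measurable_timeAverage hf N).aemeasurable]
  refine integral_congr_ae (ae_of_all _ fun x => ?_)
  dsimp only
  rw [chain_mean_timeAverage hπ hf hC hN]

omit [IsProbabilityMeasure μ₀] in
/-- **WARM-START TRANSFER FOR THE TIME AVERAGE.**  If `μ₀ ≤ M • π` (`M < ∞`; `μ₀` any measure) then for every bounded
measurable `f` and `N ≥ 1`: `E_{μ₀}[((1/N) Σ_{i<N} f(X_i) − πf)²] ≤ M · Var_{P_π}[(1/N) Σ_{i<N} f(X_i)]`
— the stationary variance that `Scoring/ChainTimeAverage.lean` identifies as `2 τ_N Var_π f / N`. -/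
theorem chain_mse_le_of_le_smul (hπ : Kernel.Invariant κ π) {M : ℝ≥0∞} (hM : M ≠ ⊤)
    (hle : μ₀ ≤ M • π) {f : Ω → ℝ} (hf : Measurable f) {C : ℝ} (hC : ∀ x, |f x| ≤ C) {N : ℕ}
    (hN : N ≠ 0) :
    ∫ x, ((∑ i ∈ Finset.range N, f (x i)) / N - ∫ z, f z ∂π) ^ 2
        ∂(Kernel.trajMeasure (X := fun _ : ℕ => Ω) μ₀
          (fun n : ℕ => κ.comap (fun h : (i : ↥(Finset.Iic n)) → Ω => h ⟨n, Finset.mem_Iic.2 le_rfl⟩)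
            (measurable_pi_apply _)))
      ≤ M.toReal * Var[fun x : ℕ → Ω => (∑ i ∈ Finset.range N, f (x i)) / N;
          Kernel.trajMeasure (X := fun _ : ℕ => Ω) π
            (fun n : ℕ => κ.comap (fun h : (i : ↥(Finset.Iic n)) → Ω => h ⟨n, Finset.mem_Iic.2 le_rfl⟩)
              (measurable_pi_apply _))] := by
  rw [← chain_sqError_eq_variance hπ hf hC hN]
  set m := ∫ z, f z ∂π with hm
  have hmeas : Measurable fun x : ℕ → Ω => ((∑ i ∈ Finset.range N, f (x i)) / N - m) ^ 2 :=
    ((measurable_timeAverage hf N).sub measurable_const).pow_const 2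
  have hbd : ∀ x : ℕ → Ω, |((∑ i ∈ Finset.range N, f (x i)) / N - m) ^ 2| ≤ (C + |m|) ^ 2 := fun x => by
    have hAm : |(∑ i ∈ Finset.range N, f (x i)) / N - m| ≤ C + |m| :=
      (abs_sub _ _).trans (add_le_add (abs_timeAverage_le hC hN x) le_rfl)
    rw [abs_pow]
    exact sq_le_sq' (by linarith [abs_nonneg ((∑ i ∈ Finset.range N, f (x i)) / N - m)]) hAm
  exact integral_le_of_le_smul hM (trajMeasure_le_smul _ hle) (fun x => sq_nonneg _)
    (integrable_of_bounded _ hmeas hbd)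

omit [IsProbabilityMeasure μ₀] in
/-- **… with a Doeblin certificate**: `μ₀ ≤ M • π` and `κ(x, ·) ≥ ε π` (`ε > 0`) give
`E_{μ₀}[((1/N) Σ_{i<N} f(X_i) − πf)²] ≤ M (2/ε − 1) · Var_π f / N`. -/
theorem chain_mse_le_of_le_smul_doeblin (hπ : Kernel.Invariant κ π) {M : ℝ≥0∞} (hM : M ≠ ⊤)
    (hle : μ₀ ≤ M • π) {ε : ℝ≥0∞} (hmin : ∀ x {B : Set Ω}, MeasurableSet B → ε * π B ≤ κ x B)
    (hε0 : 0 < ε) {f : Ω → ℝ} (hf : Measurable f) {C : ℝ} (hC : ∀ x, |f x| ≤ C) {N : ℕ}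
    (hN : N ≠ 0) :
    ∫ x, ((∑ i ∈ Finset.range N, f (x i)) / N - ∫ z, f z ∂π) ^ 2
        ∂(Kernel.trajMeasure (X := fun _ : ℕ => Ω) μ₀
          (fun n : ℕ => κ.comap (fun h : (i : ↥(Finset.Iic n)) → Ω => h ⟨n, Finset.mem_Iic.2 le_rfl⟩)
            (measurable_pi_apply _)))
      ≤ M.toReal * ((2 / ε.toReal - 1) * autocov κ π (fun y => f y - ∫ z, f z ∂π) 0 / N) :=
  (chain_mse_le_of_le_smul hπ hM hle hf hC hN).trans (mul_le_mul_of_nonneg_left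
    (variance_timeAverage_le_of_doeblin hπ hmin hε0 hf hC hN) ENNReal.toReal_nonneg)

end Chain

/-! ### The exact flow sampler started from a draw of its own model -/

section Lattice

open Literature.MathematicalPhysics.QuantumFieldTheory
open Literature.MathematicalPhysics.QuantumFieldTheory.Luscher2010
open Summit.Ventures.LatticeQCDFlow.TrivializingMaps
open scoped Matrix Matrix.Norms.Frobenius ContDiff

variable {d L n : ℕ} [NeZero L]

/-- **The exact flow sampler from a model draw — UNCONDITIONAL.**  Under the hypotheses of
`Scoring.flowSampler_autocorrelation` (smooth `S`, jointly smooth flow action with uniform defect `δ`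
of Lüscher's equation on `[0,1] × SU(n)^E`, `𝓕` integrating `−∂S̃_t`, `q = (𝓕_1)_* D[V]`): with the
weight `w` of `flowSampler_exact_doeblin` (`w · q = π := 𝒵⁻¹e^{−S}D[U]`, `K = indepMH q w` EXACT), the
chain `U_0 ∼ q, U_1, …` with kernel `K` STARTED FROM THE MODEL satisfies, for every bounded measurable
`f` and every `N ≥ 1`:
`E_q[((1/N) Σ_{i<N} f(U_i) − ∫ f dπ)²] ≤ e^{2δ} · (2e^{2δ} − 1) · Var_π f / N`. -/
theorem flowSampler_mse_from_model_le (B : SuBasis n)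
    {S : AmbConfig d L n → ℝ} (hS : ContDiff ℝ ∞ S) {F : ℝ → AmbConfig d L n → ℝ}
    (hF : ContDiff ℝ ∞ fun p : ℝ × AmbConfig d L n => F p.1 p.2)
    {Φ : ℝ → GaugeConfig d L (Matrix.specialUnitaryGroup (Fin n) ℂ) →
      GaugeConfig d L (Matrix.specialUnitaryGroup (Fin n) ℂ)}
    (hΦ : IsFlowMap (fun t W => -linkGrad B (F t) W) Φ) {c : ℝ → ℝ} {δ : ℝ}
    (hδ : ∀ t ∈ Set.Icc (0 : ℝ) 1, ∀ U : GaugeConfig d L (Matrix.specialUnitaryGroup (Fin n) ℂ),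
      |luscherL B S t (F t) (WilsonFlow.coeConfig U) - S (WilsonFlow.coeConfig U) - c t| ≤ δ)
    (q : Measure (GaugeConfig d L (Matrix.specialUnitaryGroup (Fin n) ℂ))) [IsProbabilityMeasure q]
    (hq : q = Measure.map (Φ 1) (trivialMeasure (Matrix.specialUnitaryGroup (Fin n) ℂ) d L)) :
    ∃ w : GaugeConfig d L (Matrix.specialUnitaryGroup (Fin n) ℂ) → ℝ, ∃ hw : Measurable w,
      (q.withDensity fun U => ENNReal.ofReal (w U)) =
        boltzmannMeasure (fun U : GaugeConfig d L (Matrix.specialUnitaryGroup (Fin n) ℂ) =>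
          S (WilsonFlow.coeConfig U)) ∧
      Kernel.Invariant (indepMH q w)
        (boltzmannMeasure fun U : GaugeConfig d L (Matrix.specialUnitaryGroup (Fin n) ℂ) =>
          S (WilsonFlow.coeConfig U)) ∧
      ∀ (f : GaugeConfig d L (Matrix.specialUnitaryGroup (Fin n) ℂ) → ℝ), Measurable f →
        ∀ C : ℝ, (∀ U, |f U| ≤ C) → ∀ N : ℕ, N ≠ 0 →
        let π := boltzmannMeasure fun U : GaugeConfig d L (Matrix.specialUnitaryGroup (Fin n) ℂ) =>
          S (WilsonFlow.coeConfig U)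
        haveI : Fact (Measurable w) := ⟨hw⟩
        ∫ x, ((∑ i ∈ Finset.range N, f (x i)) / N - ∫ V, f V ∂π) ^ 2
            ∂(Kernel.trajMeasure (X := fun _ : ℕ => GaugeConfig d L (Matrix.specialUnitaryGroup (Fin n) ℂ))
              q (fun m : ℕ => (indepMH q w).comap
                (fun h : (i : ↥(Finset.Iic m)) → GaugeConfig d L (Matrix.specialUnitaryGroup (Fin n) ℂ) =>
                  h ⟨m, Finset.mem_Iic.2 le_rfl⟩) (measurable_pi_apply _)))
          ≤ Real.exp (2 * δ) * ((2 * Real.exp (2 * δ) - 1)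
              * autocov (indepMH q w) π (fun U => f U - ∫ V, f V ∂π) 0 / N) := by
  obtain ⟨w, hw, hwlo, -, hπ, hinv, -, hdoeb⟩ := flowSampler_exact_doeblin B hS hF hΦ hδ q hq
  haveI : Fact (Measurable w) := ⟨hw⟩
  have hS'c : Continuous fun U : GaugeConfig d L (Matrix.specialUnitaryGroup (Fin n) ℂ) =>
      S (WilsonFlow.coeConfig U) := hS.continuous.comp WilsonFlow.continuous_coeConfig
  haveI := isProbabilityMeasure_boltzmannMeasure (d := d) (L := L) hS'c
  have hε0 : 0 < ENNReal.ofReal (Real.exp (-(2 * δ))) := ENNReal.ofReal_pos.2 (Real.exp_pos _)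
  -- the model start is dominated: `q ≤ e^{2δ} • π`
  have hdom := le_smul_of_withDensity_eq (Real.exp_pos (-(2 * δ))) hwlo hπ
  have hexp : (Real.exp (-(2 * δ)))⁻¹ = Real.exp (2 * δ) := by rw [Real.exp_neg, inv_inv]
  rw [hexp] at hdom
  refine ⟨w, hw, hπ, hinv, fun f hf C hC N hN => ?_⟩
  have h := chain_mse_le_of_le_smul_doeblin (κ := indepMH q w) (μ₀ := q) hinv ENNReal.ofReal_ne_top
    hdom (fun x B hB => hdoeb x hB) hε0 hf hC hN
  have h1 : 2 / (ENNReal.ofReal (Real.exp (-(2 * δ)))).toReal - 1 = 2 * Real.exp (2 * δ) - 1 := by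
    rw [ENNReal.toReal_ofReal (Real.exp_pos _).le, Real.exp_neg, div_inv_eq_mul]
  have h2 : (ENNReal.ofReal (Real.exp (2 * δ))).toReal = Real.exp (2 * δ) :=
    ENNReal.toReal_ofReal (Real.exp_pos _).le
  rw [h1, h2] at h
  exact h

end Lattice

end Summit.Ventures.LatticeQCDFlow.Scoring

end
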